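import Literature.MathematicalPhysics.QuantumLattice.GibbsEnergyEntropyBalance
import Literature.MathematicalPhysics.QuantumLattice.InfVolFermionStateTorusLimitLocalStability
import Literature.MathematicalPhysics.QuantumLattice.CompressedFormOnSector
import HarnessLib

/-!
# The linearised energy–entropy balance inequality and stationarity for the TRANSLATED canonical
# Gibbs eigen-mixtures of the `t–t'` Hubbard torus

Topic `Literature/MathematicalPhysics/QuantumLattice`; finite-volume companion of
`GibbsEnergyEntropyBalance.lean` (the linearised Araki–Sewell rows
`0 ≤ Σ_a w_a Re⟨ψ_a, (β·Bᴴ(AB − BA) − s·BᴴB + q·BBᴴ)ψ_a⟩`, `e^{s−1} ≤ q`, for the canonical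
eigen-mixture of a Hermitian matrix in an invariant coordinate sector) on the way to the thermal rows
of torus-limit states (`InfVolFermionStateTorusLimitEnergyEntropyBalance.lean`). Torus-limit states
are limits of TRANSLATION-AVERAGED torus expectations `|𝕋|⁻¹ Σ_v ⟨U_vψ, X U_vψ⟩`
(`torusAvgExpectAt`), so the finite-volume inequality is needed for the translated mixtures
`(p_{L,i}, U_v ψ_{L,i})` of the canonical Gibbs data `sectorGibbsWeightTT'`, `sectorGibbsVectorTT'`
(`TorusSectorGibbsMixture.lean`) of `H_L = hubbardTorusTT' L t t' U` on the sector
`(rectN n L, S^z = 0)`: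

* §1 (generic matrices) **unitary covariance**: for `U` unitary commuting with `A`,
  `⟨Uψ, X_{β,s,q}(A,B) Uψ⟩ = ⟨ψ, X_{β,s,q}(A, UᴴBU) ψ⟩` (`conjTranspose_mul_eeb_mul_of_commute`,
  `star_mulVec_dotProduct_eeb_mulVec_mulVec`), hence the sector inequality for `(w_a, Uψ_a)` when
  `U`, `Uᴴ` preserve the sector (`sum_canonicalWeight_mul_re_expect_eeb_mulVec_nonneg`), and
  stationarity in `Uψ` (`star_mulVec_dotProduct_commutator_mulVec_mulVec_eq_zero`); unitarity is taken
  in the instance-free form `Uᴴ(UX) = X`, `U(UᴴX) = X`;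
* §2 (the torus) operators commuting with `N` and `S^z`, their adjoints, and the translation
  unitaries `U_v = fockTranslate v` have no matrix entries from the sector configurations
  `szConfig n L` to the others (`apply_eq_zero_of_szConfig_of_commute`,
  `conjTranspose_apply_eq_zero_of_szConfig_of_commute`, `fockTranslate_apply_eq_zero_of_szConfig`);
  `U_vᴴ = U_{−v}`, `U_vᴴ(U_vX) = X = U_v(U_vᴴX)`; and the two finite-volume statements
  **`0 ≤ Σ_i p_{L,i} Re⟨U_vψ_{L,i}, (β·Bᴴ(H_L B − BH_L) − s·BᴴB + q·BBᴴ) U_vψ_{L,i}⟩`** for every torus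
  operator `B` commuting with `N`, `S^z` and `e^{s−1} ≤ q`
  (`sum_sectorGibbsWeightTT'_mul_re_expect_eeb_fockTranslate_nonneg`), and
  `⟨U_vψ_{L,i}, (H_L X − X H_L) U_vψ_{L,i}⟩ = 0` for every `X`
  (`star_fockTranslate_mulVec_dotProduct_commutator_mulVec_eq_zero`). No hypothesis on `β, t, t', U, n`.

Everything is PROVED; no definition, no named fact, no instance.

## Mathlib / tree search

REUSED: `sum_canonicalWeight_mul_re_expect_eeb_nonneg`, `mul_apply_eq_zero_off`,
`apply_eq_zero_off_of_mulVec_mem`, `star_dotProduct_commutator_mulVec_eq_zero_of_eigenvector`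
(`GibbsEnergyEntropyBalance`); `sectorGibbs*TT'`, `hubbardTorusTT'_mulVec_sectorGibbsVectorTT'`,
`hubbardTorusTT'_apply_eq_zero_of_szConfig`, `mem_szSector_rectN_iff`, `sectorGibbsIndex`
(`TorusSectorGibbsMixture`); `fockTranslate_commute_hubbardTorusTT'`, `fockTranslate_mulVec_mem_szSector`,
`fockTranslate_neg`, `mulVec_mem_szSector_of_commute`, `Matrix.mem_unitaryGroup_iff(')`,
`totalNumber_eq_numberDiag_univ`, `numberDiag_conjTranspose`, `HubbardWave0.spinZ_isHermitian`,
`star_mulVec_dotProduct_mulVec_mulVec` (`CompressedFormOnSector`).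
`lean search 'fockTranslate.*sectorGibbs|eeb'`: nothing before this file (2026-08-26).

## References

* H. Fawzi, O. Fawzi, S. O. Scalet, Nat. Commun. 15 (2024) 7394 = arXiv:2311.18706, §3.1 Thm. 3.1.
  [cite: FawziFawziScalet2024, Thm. 3.1]
* O. Bratteli, D. W. Robinson, *Operator Algebras and Quantum Statistical Mechanics 2* (1997),
  §5.2.2 Thm. 5.2.5 (unitarily implemented one-particle symmetries), Thm. 5.3.15.
  [cite: BratteliRobinsonII1997, Thm. 5.3.15]
* E. H. Lieb, Phys. Rev. Lett. 62 (1989) 1201, Remark (2) (`H` conserves `N↑`, `N↓`; sectors).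
  [cite: LiebPRL1989, Remark (2)]
-/

noncomputable section

namespace Literature.MathematicalPhysics.QuantumLattice

open Matrix Finset HubbardWave0 Literature.Probability.LatticeModels ThermodynamicLimit
open _root_.Filter
open scoped _root_.Topology ComplexOrder BigOperators

/-! ### §1 Covariance: the EEB functional in unitarily transformed eigen-mixtures

If `U` is unitary and commutes with the Hamiltonian `A`, then
`⟨Uψ, X_{β,s,q}(A,B) Uψ⟩ = ⟨ψ, X_{β,s,q}(A, UᴴBU) ψ⟩` for the linearised EEB observable
`X_{β,s,q}(A,B) = β·Bᴴ(AB − BA) − s·BᴴB + q·BBᴴ`; so the linearised EEB inequality for the canonical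
sector eigen-mixture `(w_a, ψ_a)` also holds for the transformed mixture `(w_a, Uψ_a)` whenever `U`
and `Uᴴ` preserve the sector (on the torus: `U` a lattice translation, as in the translation
averages defining torus-limit states). -/

section Covariance

variable {ι : Type*} [Fintype ι] [DecidableEq ι]

omit [DecidableEq ι] in
/-- **Unitary covariance of the linearised EEB observable**: for `U` unitary commuting with `A`,
`Uᴴ X_{β,s,q}(A,B) U = X_{β,s,q}(A, UᴴBU)`. [cite: FawziFawziScalet2024, Thm. 3.1] -/
theorem conjTranspose_mul_eeb_mul_of_commute {U A : Matrix ι ι ℂ} (hU : ∀ X : Matrix ι ι ℂ, Uᴴ * (U * X) = X)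
    (hU' : ∀ X : Matrix ι ι ℂ, U * (Uᴴ * X) = X) (hUA : Commute U A) (B : Matrix ι ι ℂ) (β s q : ℝ) :
    Uᴴ * (((β : ℝ) : ℂ) • (Bᴴ * (A * B - B * A)) - ((s : ℝ) : ℂ) • (Bᴴ * B) +
        ((q : ℝ) : ℂ) • (B * Bᴴ)) * U =
      ((β : ℝ) : ℂ) • ((Uᴴ * B * U)ᴴ * (A * (Uᴴ * B * U) - (Uᴴ * B * U) * A)) -
        ((s : ℝ) : ℂ) • ((Uᴴ * B * U)ᴴ * (Uᴴ * B * U)) +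
        ((q : ℝ) : ℂ) • ((Uᴴ * B * U) * (Uᴴ * B * U)ᴴ) := by
  have hconj : ∀ Y Z : Matrix ι ι ℂ, Uᴴ * (Y * Z) * U = (Uᴴ * Y * U) * (Uᴴ * Z * U) := by
    intro Y Z
    calc Uᴴ * (Y * Z) * U = Uᴴ * Y * (Z * U) := by simp only [Matrix.mul_assoc]
      _ = Uᴴ * Y * (U * (Uᴴ * (Z * U))) := by rw [hU']
      _ = (Uᴴ * Y * U) * (Uᴴ * Z * U) := by simp only [Matrix.mul_assoc]
  have hA : Uᴴ * A * U = A := by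
    rw [Matrix.mul_assoc, ← hUA.eq, hU]
  have hBt : (Uᴴ * B * U)ᴴ = Uᴴ * Bᴴ * U := by
    rw [conjTranspose_mul, conjTranspose_mul, conjTranspose_conjTranspose, Matrix.mul_assoc]
  rw [hBt]
  simp only [Matrix.mul_add, Matrix.mul_sub, Matrix.add_mul, Matrix.sub_mul, Matrix.mul_smul,
    Matrix.smul_mul, hconj, hA]

omit [DecidableEq ι] in
/-- The EEB expectation in a transformed vector is the EEB expectation, in the original vector,
of the transformed observable `UᴴBU` (`U` unitary commuting with `A`).
[cite: FawziFawziScalet2024, Thm. 3.1] -/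
theorem star_mulVec_dotProduct_eeb_mulVec_mulVec {U A : Matrix ι ι ℂ} (hU : ∀ X : Matrix ι ι ℂ, Uᴴ * (U * X) = X)
    (hU' : ∀ X : Matrix ι ι ℂ, U * (Uᴴ * X) = X) (hUA : Commute U A) (B : Matrix ι ι ℂ) (β s q : ℝ)
    (ψ : ι → ℂ) :
    star (U *ᵥ ψ) ⬝ᵥ ((((β : ℝ) : ℂ) • (Bᴴ * (A * B - B * A)) - ((s : ℝ) : ℂ) • (Bᴴ * B) +
        ((q : ℝ) : ℂ) • (B * Bᴴ)) *ᵥ (U *ᵥ ψ)) =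
      star ψ ⬝ᵥ ((((β : ℝ) : ℂ) • ((Uᴴ * B * U)ᴴ * (A * (Uᴴ * B * U) - (Uᴴ * B * U) * A)) -
        ((s : ℝ) : ℂ) • ((Uᴴ * B * U)ᴴ * (Uᴴ * B * U)) +
        ((q : ℝ) : ℂ) • ((Uᴴ * B * U) * (Uᴴ * B * U)ᴴ)) *ᵥ ψ) := by
  rw [star_mulVec_dotProduct_mulVec_mulVec U _ ψ ψ, conjTranspose_mul_eeb_mul_of_commute hU hU' hUA]

variable (p : ι → Prop) [DecidablePred p]

/-- **Linearised EEB for unitarily transformed canonical sector eigen-mixtures.** Under the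
hypotheses of `sum_canonicalWeight_mul_re_expect_eeb_nonneg`, if moreover `U` is unitary, commutes
with `A`, and `U`, `Uᴴ` have no entries between the sector and its complement, then the mixture
`(w_a, Uψ_a)` also satisfies `0 ≤ Σ_a w_a · Re ⟨Uψ_a, (β·Bᴴ(AB − BA) − s·BᴴB + q·BBᴴ) Uψ_a⟩`
(covariance: this is the inequality for the sector-preserving observable `UᴴBU` in the original
mixture). [cite: FawziFawziScalet2024, Thm. 3.1] -/
theorem sum_canonicalWeight_mul_re_expect_eeb_mulVec_nonneg {A : Matrix ι ι ℂ} (hA : A.IsHermitian)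
    (hinv : ∀ i j, ¬ p i → p j → A i j = 0) {U : Matrix ι ι ℂ} (hU : ∀ X : Matrix ι ι ℂ, Uᴴ * (U * X) = X)
    (hU' : ∀ X : Matrix ι ι ℂ, U * (Uᴴ * X) = X) (hUA : Commute U A)
    (hUp : ∀ i j, ¬ p i → p j → U i j = 0) (hUp' : ∀ i j, ¬ p i → p j → Uᴴ i j = 0)
    {B : Matrix ι ι ℂ} (hB : ∀ i j, ¬ p i → p j → B i j = 0) (hB' : ∀ i j, ¬ p i → p j → Bᴴ i j = 0)
    (β : ℝ) {s q : ℝ} (hq : Real.exp (s - 1) ≤ q) :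
    0 ≤ ∑ a, canonicalWeight β (sectorEigenvalue p A hA) a *
      (star (U *ᵥ sectorEigenvector p A hA a) ⬝ᵥ
        ((((β : ℝ) : ℂ) • (Bᴴ * (A * B - B * A)) - ((s : ℝ) : ℂ) • (Bᴴ * B) +
            ((q : ℝ) : ℂ) • (B * Bᴴ)) *ᵥ (U *ᵥ sectorEigenvector p A hA a))).re := by
  have hB₁ : ∀ i j, ¬ p i → p j → (Uᴴ * B * U) i j = 0 :=
    mul_apply_eq_zero_off p (mul_apply_eq_zero_off p hUp' hB) hUp
  have hB₂ : ∀ i j, ¬ p i → p j → (Uᴴ * B * U)ᴴ i j = 0 := by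
    have h : (Uᴴ * B * U)ᴴ = Uᴴ * Bᴴ * U := by
      rw [conjTranspose_mul, conjTranspose_mul, conjTranspose_conjTranspose, Matrix.mul_assoc]
    rw [h]
    exact mul_apply_eq_zero_off p (mul_apply_eq_zero_off p hUp' hB') hUp
  refine (sum_canonicalWeight_mul_re_expect_eeb_nonneg p hA hinv hB₁ hB₂ β hq).trans_eq
    (Finset.sum_congr rfl fun a _ => ?_)
  rw [star_mulVec_dotProduct_eeb_mulVec_mulVec hU hU' hUA]

omit [DecidableEq ι] in
/-- **Stationarity in transformed eigenvectors**: if `Aψ = Eψ` and `U` commutes with `A`, then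
`⟨Uψ, (AX − XA) Uψ⟩ = 0` for every `X` (`Uψ` is again an eigenvector).
[cite: FawziFawziScalet2024, Thm. 3.1] -/
theorem star_mulVec_dotProduct_commutator_mulVec_mulVec_eq_zero {A : Matrix ι ι ℂ} (hA : A.IsHermitian)
    {U : Matrix ι ι ℂ} (hUA : Commute U A) {ψ : ι → ℂ} {E : ℝ} (hψ : A *ᵥ ψ = ((E : ℝ) : ℂ) • ψ)
    (X : Matrix ι ι ℂ) :
    star (U *ᵥ ψ) ⬝ᵥ ((A * X - X * A) *ᵥ (U *ᵥ ψ)) = 0 := by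
  have hUψ : A *ᵥ (U *ᵥ ψ) = ((E : ℝ) : ℂ) • (U *ᵥ ψ) := by
    rw [mulVec_mulVec, ← hUA.eq, ← mulVec_mulVec, hψ, mulVec_smul]
  exact star_dotProduct_commutator_mulVec_eq_zero_of_eigenvector hA hUψ X

end Covariance

/-! ### §2 The canonical sector Gibbs state of the `t–t'` torus: sector bookkeeping, the EEB
inequality and stationarity in the translated eigen-mixtures `(p_{L,i}, U_v ψ_{L,i})` -/

section TorusUnitarity

/-- `Uᴴ(UX) = X` from `U⋆U = 1`; the `DecidableEq` instance is an implicit ARGUMENT, so that the lemma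
instantiates at the instance carried by a given unitary-group element (on the torus orbitals two
`DecidableEq` instances coexist, cf. the implementation note of `FockRelabel.lean`). [folklore] -/
private theorem conjTranspose_mul_mul_of_star_mul_self {ι : Type*} [Fintype ι] {_dec : DecidableEq ι}
    {U : Matrix ι ι ℂ} (h : star U * U = 1) (X : Matrix ι ι ℂ) : Uᴴ * (U * X) = X := by
  rw [← Matrix.mul_assoc, ← Matrix.star_eq_conjTranspose, h, Matrix.one_mul]

/-- `U(UᴴX) = X` from `UU⋆ = 1` (same remark). [folklore] -/
private theorem mul_conjTranspose_mul_of_mul_star_self {ι : Type*} [Fintype ι] {_dec : DecidableEq ι}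
    {U : Matrix ι ι ℂ} (h : U * star U = 1) (X : Matrix ι ι ℂ) : U * (Uᴴ * X) = X := by
  rw [← Matrix.mul_assoc, ← Matrix.star_eq_conjTranspose, h, Matrix.one_mul]

variable (L : ℕ) [NeZero L]

/-- `U_vᴴ (U_v X) = X` (unitarity of the translations, in instance-free form).
[cite: BratteliRobinsonII1997, §5.2.2, Thm. 5.2.5] -/
theorem fockTranslate_val_conjTranspose_mul_val_mul (v : TorusSite 2 L)
    (X : Matrix (Finset (Orb (FermionTorus 2 L))) (Finset (Orb (FermionTorus 2 L))) ℂ) :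
    (fockTranslate v).valᴴ * ((fockTranslate v).val * X) = X :=
  conjTranspose_mul_mul_of_star_mul_self (fockTranslate v).2.1 X

/-- `U_v (U_vᴴ X) = X`. [cite: BratteliRobinsonII1997, §5.2.2, Thm. 5.2.5] -/
theorem fockTranslate_val_mul_val_conjTranspose_mul (v : TorusSite 2 L)
    (X : Matrix (Finset (Orb (FermionTorus 2 L))) (Finset (Orb (FermionTorus 2 L))) ℂ) :
    (fockTranslate v).val * ((fockTranslate v).valᴴ * X) = X :=
  mul_conjTranspose_mul_of_mul_star_self (fockTranslate v).2.2 X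

end TorusUnitarity

section Torus

variable (L : ℕ)

/-- Canonical weights are invariant under reindexing the family of energies. [folklore] -/
private theorem canonicalWeight_comp_equiv {κ κ' : Type*} [Fintype κ] [Fintype κ'] (e : κ' ≃ κ)
    (β : ℝ) (E : κ → ℝ) (a : κ') :
    canonicalWeight β (E ∘ e) a = canonicalWeight β E (e a) := by
  unfold canonicalWeight
  rw [show (∑ b, Real.exp (-(β * (E ∘ e) b))) = ∑ b, Real.exp (-(β * E b)) from
    Equiv.sum_comp e (fun b => Real.exp (-(β * E b)))]
  rfl

/-- **An operator on the torus Fock space commuting with `N` and `S^z` has no matrix entries from the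
sector `(rectN n L, S^z = 0)` to its complement** (it maps `szSector (rectN n L) 0` into itself,
`mulVec_mem_szSector_of_commute`). [cite: LiebPRL1989, Remark (2)] -/
theorem apply_eq_zero_of_szConfig_of_commute (n : ℝ)
    {B : Matrix (Finset (Orb (FermionTorus 2 L))) (Finset (Orb (FermionTorus 2 L))) ℂ}
    (hN : Commute B totalNumber) (hS : Commute B HubbardWave0.spinZ)
    (s s' : Finset (Orb (FermionTorus 2 L))) (hs : ¬ szConfig n L s) (hs' : szConfig n L s') :
    B s s' = 0 :=
  apply_eq_zero_off_of_mulVec_mem (szConfig n L) (szSector (rectN n L) 0) (mem_szSector_rectN_iff n L)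
    (fun _ hv => mulVec_mem_szSector_of_commute hN hS hv) s s' hs hs'

/-- The adjoint of an operator commuting with `N` and `S^z` commutes with them as well (both are
Hermitian), hence also has no entries from the sector to its complement. [cite: LiebPRL1989, Remark (2)] -/
theorem conjTranspose_apply_eq_zero_of_szConfig_of_commute (n : ℝ)
    {B : Matrix (Finset (Orb (FermionTorus 2 L))) (Finset (Orb (FermionTorus 2 L))) ℂ}
    (hN : Commute B totalNumber) (hS : Commute B HubbardWave0.spinZ)
    (s s' : Finset (Orb (FermionTorus 2 L))) (hs : ¬ szConfig n L s) (hs' : szConfig n L s') :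
    Bᴴ s s' = 0 := by
  have hNh : (totalNumber : Matrix (Finset (Orb (FermionTorus 2 L))) (Finset (Orb (FermionTorus 2 L))) ℂ)ᴴ =
      totalNumber := by
    rw [totalNumber_eq_numberDiag_univ]
    exact numberDiag_conjTranspose _
  have hN' : Commute Bᴴ totalNumber := by
    have h := congrArg conjTranspose hN.eq
    rw [conjTranspose_mul, conjTranspose_mul, hNh] at h
    exact h.symm
  have hS' : Commute Bᴴ HubbardWave0.spinZ := by
    have h := congrArg conjTranspose hS.eq
    rw [conjTranspose_mul, conjTranspose_mul, HubbardWave0.spinZ_isHermitian.eq] at h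
    exact h.symm
  exact apply_eq_zero_of_szConfig_of_commute L n hN' hS' s s' hs hs'

variable [NeZero L]

/-- The translation unitaries `U_v` have no entries from the sector `(rectN n L, S^z = 0)` to its
complement (they preserve every joint sector, `fockTranslate_mulVec_mem_szSector`).
[cite: BratteliRobinsonII1997, §5.2.2, Thm. 5.2.5] -/
theorem fockTranslate_apply_eq_zero_of_szConfig (v : TorusSite 2 L) (n : ℝ)
    (s s' : Finset (Orb (FermionTorus 2 L))) (hs : ¬ szConfig n L s) (hs' : szConfig n L s') :
    (fockTranslate v).val s s' = 0 :=
  apply_eq_zero_off_of_mulVec_mem (szConfig n L) (szSector (rectN n L) 0) (mem_szSector_rectN_iff n L)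
    (fun _ hv => fockTranslate_mulVec_mem_szSector v hv) s s' hs hs'

/-- `U_vᴴ = U_{-v}`. [cite: BratteliRobinsonII1997, §5.2.2, Thm. 5.2.5] -/
theorem fockTranslate_val_conjTranspose_eq_neg (v : TorusSite 2 L) :
    (fockTranslate v).valᴴ = (fockTranslate (-v)).val := by
  rw [fockTranslate_neg]
  rfl

/-- **The linearised EEB inequality for the translated canonical Gibbs mixtures of the `t–t'` torus.**
For `H_L = hubbardTorusTT' L t t' U`, the canonical Gibbs data `(p_{L,i}, ψ_{L,i})` of the sector
`(rectN n L, S^z = 0)` at inverse temperature `β`, a translation `v`, every torus operator `B`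
commuting with `N` and `S^z`, and all real `s, q` with `e^{s−1} ≤ q`:
`0 ≤ Σ_i p_{L,i} Re⟨U_vψ_{L,i}, (β·Bᴴ(H_L B − B H_L) − s·BᴴB + q·BBᴴ) U_vψ_{L,i}⟩`
(`sum_canonicalWeight_mul_re_expect_eeb_mulVec_nonneg`: `U_v` is unitary, commutes with `H_L` and
preserves the sector). No hypothesis on `β, t, t', U, n`. [cite: FawziFawziScalet2024, Thm. 3.1] -/
theorem sum_sectorGibbsWeightTT'_mul_re_expect_eeb_fockTranslate_nonneg (t t' U n β : ℝ)
    (v : TorusSite 2 L) {B : Matrix (Finset (Orb (FermionTorus 2 L))) (Finset (Orb (FermionTorus 2 L))) ℂ}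
    (hBN : Commute B totalNumber) (hBS : Commute B HubbardWave0.spinZ) {s q : ℝ}
    (hq : Real.exp (s - 1) ≤ q) :
    0 ≤ ∑ i, sectorGibbsWeightTT' β t t' U n L i *
      (star ((fockTranslate v).val *ᵥ sectorGibbsVectorTT' t t' U n L i) ⬝ᵥ
        ((((β : ℝ) : ℂ) • (Bᴴ * (hubbardTorusTT' L t t' U * B - B * hubbardTorusTT' L t t' U)) -
            ((s : ℝ) : ℂ) • (Bᴴ * B) + ((q : ℝ) : ℂ) • (B * Bᴴ)) *ᵥ
          ((fockTranslate v).val *ᵥ sectorGibbsVectorTT' t t' U n L i))).re := by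
  set H := hubbardTorusTT' L t t' U with hH
  have hA : H.IsHermitian := hubbardTorusTT'_isHermitian L t t' U
  have hinv : ∀ s s', ¬ szConfig n L s → szConfig n L s' → H s s' = 0 :=
    fun s s' hs hs' => hubbardTorusTT'_apply_eq_zero_of_szConfig L t t' U n s s' hs hs'
  have hUp' : ∀ s s', ¬ szConfig n L s → szConfig n L s' → (fockTranslate v).valᴴ s s' = 0 := by
    intro s s' hs hs'
    rw [fockTranslate_val_conjTranspose_eq_neg]
    exact fockTranslate_apply_eq_zero_of_szConfig L (-v) n s s' hs hs'
  have key := sum_canonicalWeight_mul_re_expect_eeb_mulVec_nonneg (szConfig n L) hA hinv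
    (fockTranslate_val_conjTranspose_mul_val_mul L v) (fockTranslate_val_mul_val_conjTranspose_mul L v)
    (fockTranslate_commute_hubbardTorusTT' L v t t' U)
    (fun s s' hs hs' => fockTranslate_apply_eq_zero_of_szConfig L v n s s' hs hs') hUp'
    (apply_eq_zero_of_szConfig_of_commute L n hBN hBS)
    (conjTranspose_apply_eq_zero_of_szConfig_of_commute L n hBN hBS) β hq
  -- transport the sum from `Subtype (szConfig n L)` to `Fin (sectorGibbsCount n L)`
  set e := sectorGibbsIndex n L with he
  refine key.trans_eq ?_
  rw [← Equiv.sum_comp e]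
  refine Finset.sum_congr rfl fun i _ => ?_
  rw [sectorGibbsWeightTT', show sectorGibbsEnergyTT' t t' U n L =
    sectorEigenvalue (szConfig n L) H hA ∘ e from rfl, canonicalWeight_comp_equiv]
  rfl

/-- **Stationarity of the translated Gibbs components**: every `U_v ψ_{L,i}` is an eigenvector of
`H_L` (`U_v` commutes with `H_L`), so `⟨U_vψ_{L,i}, (H_L X − X H_L) U_vψ_{L,i}⟩ = 0` for every `X`.
[cite: FawziFawziScalet2024, Thm. 3.1] -/
theorem star_fockTranslate_mulVec_dotProduct_commutator_mulVec_eq_zero (t t' U n : ℝ)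
    (v : TorusSite 2 L) (i : Fin (sectorGibbsCount n L))
    (X : Matrix (Finset (Orb (FermionTorus 2 L))) (Finset (Orb (FermionTorus 2 L))) ℂ) :
    star ((fockTranslate v).val *ᵥ sectorGibbsVectorTT' t t' U n L i) ⬝ᵥ
      ((hubbardTorusTT' L t t' U * X - X * hubbardTorusTT' L t t' U) *ᵥ
        ((fockTranslate v).val *ᵥ sectorGibbsVectorTT' t t' U n L i)) = 0 :=
  star_mulVec_dotProduct_commutator_mulVec_mulVec_eq_zero (hubbardTorusTT'_isHermitian L t t' U)
    (fockTranslate_commute_hubbardTorusTT' L v t t' U)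
    (hubbardTorusTT'_mulVec_sectorGibbsVectorTT' t t' U n L i) X

end Torus

end Literature.MathematicalPhysics.QuantumLattice

end
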